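import Literature.Probability.RandomPlanarGeometry.HexParafermion
import Literature.Probability.RandomPlanarGeometry.HexSAW
import Literature.Probability.RandomPlanarGeometry.HexDomainSingleton
import Literature.Probability.LatticeModels.TriangularLatticeProofs
import Literature.Probability.Percolation.TriLoopWinding
import HarnessLib

/-!
# Crux `SAWDevelopingMap.ObservableToSLE` (stmt-CriticalPhenomena-10472), line
`floor-ratio-restriction-bootstrap`, stub `stub_canonicalTransfer`: elementary limit, lattice and
measure lemmas for the assembly

Landing target:
`Summits/CriticalPhenomena/SAWScalingLimit/Theorems/SAWDevelopingMapObservableToSLECanonicalTransferLimit.lean`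
(`--supports stmt-CriticalPhenomena-10472`).  Companion of `…CanonicalTransferSqueeze.lean`,
`…CanonicalTransferSqueezePendant.lean` and `…CanonicalTransferFloor.lean`; consumed by the
assembly `stub_canonicalTransfer_ofDiscretisation`.

* `tendsto_of_ratio_squeeze` = registered sub-goal `stub_canonicalTransfer_limit` — the real-variable
  end of the squeeze: if `Z_{Λ'}/Z_Λ → L`, `Z_{Λ''}/Z_{Λ'} → 1`, `P(In) → 1`,
  `P(In) Z_{Λ'} ≤ P(E ∩ In) Z_Λ ≤ P(In) Z_{Λ''}` and `P(E ∩ In) ≤ P(E) ≤ P(E ∩ In) + 1 - P(In)`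
  eventually, then `P(E) → L`;
* `floor_cases_pair` — the endpoint clauses of `stub_canonicalTransfer` at BOTH marked points (same
  floor height) put the two canonical endpoints in the same case (full row / pendant) and the same
  lattice row;
* `dist_smul_hexCenter_le_of_adj` — rescaled adjacent honeycomb vertices are within `δ`;
* `segment_subset_of_floor` — segments between points of the flat part `{im > h} ∩ B(p, r)` stay
  in it;
* `exists_adj_of_reachable`, `sym2_ne_of_ne`, `sum_pow_length_pos`, `sum_pow_length_mono` —
  small combinatorial facts (first step of a walk, distinct floor mid-edges, positivity of `Z_Λ`
  and its monotonicity in `Λ`);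
* `toReal_inter_le_and_le` — `P(E ∩ I) ≤ P(E) ≤ P(E ∩ I) + (1 - P(I))` for a probability measure.
-/

noncomputable section

open scoped BigOperators Topology ENNReal
open Filter Set MeasureTheory Metric
open Literature.Probability.LatticeModels (HexVertex hexGraph hexCenter Site
  hexGraph_adj_iff_of_snd_eq_zero_holds not_hexGraph_adj_of_snd_eq_holds hexGraph_adj_iff_of_snd_eq_one
  normSq_add_mul_triZeta)
open Literature.Probability.RandomPlanarGeometry
open Literature.Probability.RandomPlanarGeometry.SAW

namespace Summit.CriticalPhenomena.SAWScalingLimit.Theorems.ObservableToSLE.FloorRatio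

/-! ### The real-variable end of the squeeze -/

/-- **The real-variable end of the squeeze** (named-hypotheses form of the registered sub-goal
`stub_canonicalTransfer_limit`).  Along a filter, if `z'/z → L`, `z''/z' → 1`, `pIn → 1`, and
eventually `z', z > 0`, `pIn·z' ≤ pEIn·z ≤ pIn·z''` and `pEIn ≤ pE ≤ pEIn + (1 - pIn)`, then
`pE → L`.  (With `z = Z_Λ`, `z' = Z_{Λ'}`, `z'' = Z_{Λ''}`, `pIn = P(In)`, `pEIn = P(E ∩ In)`,
`pE = P(E)` this is the limit step of `stub_canonicalTransfer`.) [folklore] -/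
theorem tendsto_of_ratio_squeeze {l : Filter ℝ} {pIn pEIn pE z z' z'' : ℝ → ℝ} {L : ℝ}
    (h1 : Tendsto (fun δ => z' δ / z δ) l (𝓝 L)) (h2 : Tendsto (fun δ => z'' δ / z' δ) l (𝓝 1))
    (h3 : Tendsto pIn l (𝓝 1)) (hpos : ∀ᶠ δ in l, 0 < z' δ ∧ 0 < z δ)
    (hsq : ∀ᶠ δ in l, pIn δ * z' δ ≤ pEIn δ * z δ ∧ pEIn δ * z δ ≤ pIn δ * z'' δ)
    (hE : ∀ᶠ δ in l, pEIn δ ≤ pE δ ∧ pE δ ≤ pEIn δ + (1 - pIn δ)) :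
    Tendsto pE l (𝓝 L) := by
  have hlow : Tendsto (fun δ => pIn δ * (z' δ / z δ)) l (𝓝 L) := by
    simpa using h3.mul h1
  have hup : Tendsto (fun δ => pIn δ * ((z'' δ / z' δ) * (z' δ / z δ))) l (𝓝 L) := by
    simpa using h3.mul (h2.mul h1)
  have hEIn : Tendsto pEIn l (𝓝 L) := by
    refine tendsto_of_tendsto_of_tendsto_of_le_of_le' hlow hup ?_ ?_
    · filter_upwards [hpos, hsq] with δ hp hs
      rw [mul_div_assoc', div_le_iff₀ hp.2]
      exact hs.1
    · filter_upwards [hpos, hsq] with δ hp hs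
      have : z'' δ / z' δ * (z' δ / z δ) = z'' δ / z δ := by
        rw [div_mul_div_comm, mul_comm (z' δ) (z δ), mul_div_mul_right _ _ hp.1.ne']
      rw [this, mul_div_assoc', le_div_iff₀ hp.2]
      exact hs.2
  have h0 : Tendsto (fun δ => pEIn δ + (1 - pIn δ)) l (𝓝 L) := by
    have := hEIn.add (tendsto_const_nhds.sub h3 : Tendsto (fun δ => (1 : ℝ) - pIn δ) l (𝓝 (1 - 1)))
    simpa using this
  exact tendsto_of_tendsto_of_tendsto_of_le_of_le' hEIn h0 (hE.mono fun δ h => h.1)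
    (hE.mono fun δ h => h.2)

/-- **Registered sub-goal `stub_canonicalTransfer_limit`** (crux item stmt-CriticalPhenomena-10472,
line `floor-ratio-restriction-bootstrap`, stub `stub_canonicalTransfer`): the real-variable end of
the squeeze along `𝓝[>] 0`, registry form of `tendsto_of_ratio_squeeze`. [folklore] -/
theorem stub_canonicalTransfer_limit :
    ∀ (pIn pEIn pE z z' z'' : ℝ → ℝ) (L : ℝ),
    Tendsto (fun δ => z' δ / z δ) (𝓝[>] 0) (𝓝 L) → Tendsto (fun δ => z'' δ / z' δ) (𝓝[>] 0) (𝓝 1) →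
    Tendsto pIn (𝓝[>] 0) (𝓝 1) → (∀ᶠ δ : ℝ in 𝓝[>] 0, 0 < z' δ ∧ 0 < z δ) →
    (∀ᶠ δ : ℝ in 𝓝[>] 0, pIn δ * z' δ ≤ pEIn δ * z δ ∧ pEIn δ * z δ ≤ pIn δ * z'' δ) →
    (∀ᶠ δ : ℝ in 𝓝[>] 0, pEIn δ ≤ pE δ ∧ pE δ ≤ pEIn δ + (1 - pIn δ)) →
    Tendsto pE (𝓝[>] 0) (𝓝 L) :=
  fun _ _ _ _ _ _ _ h1 h2 h3 hpos hsq hE => tendsto_of_ratio_squeeze h1 h2 h3 hpos hsq hE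

/-! ### The two canonical endpoints fall in the same floor case -/

section Floor

/-- Local copy of `im_smul_hexCenter` (`…CanonicalTransferFloor.lean`): heights of rescaled face
centres. [folklore] -/
private theorem im_smul_hexCenter_loc (δ : ℝ) (v : HexVertex) :
    ((δ : ℂ) * hexCenter v).im = δ * (((v.1 1 : ℝ) + ((v.2 : ℕ) + 1) / 3) * (Real.sqrt 3 / 2)) := by
  obtain ⟨x, k⟩ := v
  rw [Complex.mul_im, Complex.ofReal_re, Complex.ofReal_im, zero_mul, add_zero,
    Literature.Probability.Percolation.hexCenter_im]

/-- One endpoint: the endpoint clause (a honeycomb neighbour on or below the line `Im = h`, the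
vertex strictly above it) in normalised form — either `a = (x, 0)`, `u = (x - e₁, 1)` and
`(x₁ - 1/3) k ≤ h < (x₁ + 1/3) k`, or `a = (x, 1)`, the up-faces of its row are on or below the
line and `(x₁ + 1/3) k ≤ h < (x₁ + 2/3) k`, where `k = δ √3/2`. [folklore] -/
private theorem floor_case_one {h δ : ℝ} (hδ : 0 < δ) {a u : HexVertex} (hadj : hexGraph.Adj a u)
    (ha : h < ((δ : ℂ) * hexCenter a).im) (hu : ((δ : ℂ) * hexCenter u).im ≤ h) :
    (a.2 = 0 ∧ u = (a.1 - Pi.single 1 1, 1) ∧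
        ((a.1 1 : ℝ) - 1 / 3) * (δ * (Real.sqrt 3 / 2)) ≤ h ∧
          h < ((a.1 1 : ℝ) + 1 / 3) * (δ * (Real.sqrt 3 / 2))) ∨
      (a.2 = 1 ∧ ((δ : ℂ) * hexCenter (a.1, (0 : Fin 2))).im ≤ h ∧
        ((a.1 1 : ℝ) + 1 / 3) * (δ * (Real.sqrt 3 / 2)) ≤ h ∧
          h < ((a.1 1 : ℝ) + 2 / 3) * (δ * (Real.sqrt 3 / 2))) := by
  obtain ⟨x, k⟩ := a
  obtain ⟨y, l⟩ := u
  rw [im_smul_hexCenter_loc] at ha hu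
  have hlt := hu.trans_lt ha
  rw [mul_lt_mul_iff_right₀ hδ,
    mul_lt_mul_iff_left₀ (by positivity : (0 : ℝ) < Real.sqrt 3 / 2)] at hlt
  fin_cases k
  · fin_cases l
    · exact absurd hadj (not_hexGraph_adj_of_snd_eq_holds _ _ rfl)
    · rcases (hexGraph_adj_iff_of_snd_eq_zero_holds x y).1 hadj with rfl | rfl | rfl
      · simp at hlt; linarith
      · simp at hlt; linarith
      · refine Or.inl ⟨rfl, rfl, ?_, ?_⟩
        · simp at hu; linarith
        · simp at ha; linarith
  · fin_cases l
    · have hy : y 1 = x 1 := by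
        rcases (hexGraph_adj_iff_of_snd_eq_one x y).1 hadj with rfl | rfl | rfl
        · rfl
        · simp
        · simp at hlt; linarith
      refine Or.inr ⟨rfl, ?_, ?_, ?_⟩
      · rw [im_smul_hexCenter_loc]
        simp only [hy, Fin.val_zero, Nat.cast_zero] at hu ⊢
        exact hu
      · simp [hy] at hu; linarith
      · simp at ha; linarith
    · exact absurd hadj (not_hexGraph_adj_of_snd_eq_holds _ _ rfl)

/-- **Both endpoints fall in the same floor case and the same row.**  If two honeycomb vertices
`a`, `b` strictly above the line `Im = h` have neighbours `u_a`, `u_b` on or below it, then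
either both are up-faces `(x, 0)`, `(y, 0)` of the same row `x₁ = y₁` with `u_a = (x - e₁, 1)`,
`u_b = (y - e₁, 1)` (full lowest row), or both are down-faces `(x, 1)`, `(y, 1)` of the same row
with the up-faces of that row on or below the line (pendant lowest row). [folklore] -/
theorem floor_cases_pair {h δ : ℝ} (hδ : 0 < δ) {a ua b ub : HexVertex}
    (hadja : hexGraph.Adj a ua) (ha : h < ((δ : ℂ) * hexCenter a).im)
    (hua : ((δ : ℂ) * hexCenter ua).im ≤ h)
    (hadjb : hexGraph.Adj b ub) (hb : h < ((δ : ℂ) * hexCenter b).im)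
    (hub : ((δ : ℂ) * hexCenter ub).im ≤ h) :
    (a.2 = 0 ∧ b.2 = 0 ∧ b.1 1 = a.1 1 ∧ ua = (a.1 - Pi.single 1 1, 1) ∧
        ub = (b.1 - Pi.single 1 1, 1)) ∨
      (a.2 = 1 ∧ b.2 = 1 ∧ b.1 1 = a.1 1 ∧ ((δ : ℂ) * hexCenter (a.1, (0 : Fin 2))).im ≤ h ∧
        ((δ : ℂ) * hexCenter (b.1, (0 : Fin 2))).im ≤ h) := by
  have hk : 0 < δ * (Real.sqrt 3 / 2) := by positivity
  set k := δ * (Real.sqrt 3 / 2) with hkdef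
  have hint : ∀ {A B : ℤ} {s t : ℝ}, ((A : ℝ) + s) * k ≤ h → h < ((B : ℝ) + t) * k → t ≤ s + 1 →
      A ≤ B := by
    intro A B s t h1 h2 hst
    have hlt : ((A : ℝ) + s) * k < ((B : ℝ) + t) * k := h1.trans_lt h2
    have hlt' := lt_of_mul_lt_mul_right hlt hk.le
    by_contra hAB
    push Not at hAB
    have : (B : ℝ) + 1 ≤ A := by exact_mod_cast hAB
    linarith
  rcases floor_case_one hδ hadja ha hua with ⟨ha0, hua', ha1, ha2⟩ | ⟨ha1', hax, ha1, ha2⟩ <;>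
    rcases floor_case_one hδ hadjb hb hub with ⟨hb0, hub', hb1, hb2⟩ | ⟨hb1', hbx, hb1, hb2⟩
  · refine Or.inl ⟨ha0, hb0, le_antisymm ?_ ?_, hua', hub'⟩
    · exact hint (s := -(1 / 3)) (t := 1 / 3) (by simpa [sub_eq_add_neg] using hb1) ha2 (by norm_num)
    · exact hint (s := -(1 / 3)) (t := 1 / 3) (by simpa [sub_eq_add_neg] using ha1) hb2 (by norm_num)
  · exfalso
    have h1 : b.1 1 ≤ a.1 1 - 1 := by
      have := hint (s := 1 / 3) (t := 1 / 3) hb1 ha2 (by norm_num)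
      have h' : b.1 1 ≠ a.1 1 := by
        intro heq
        rw [heq] at hb1
        linarith
      omega
    have : (b.1 1 : ℝ) ≤ a.1 1 - 1 := by exact_mod_cast h1
    nlinarith
  · exfalso
    have h1 : a.1 1 ≤ b.1 1 - 1 := by
      have := hint (s := 1 / 3) (t := 1 / 3) ha1 hb2 (by norm_num)
      have h' : a.1 1 ≠ b.1 1 := by
        intro heq
        rw [heq] at ha1
        linarith
      omega
    have : (a.1 1 : ℝ) ≤ b.1 1 - 1 := by exact_mod_cast h1
    nlinarith
  · refine Or.inr ⟨ha1', hb1', le_antisymm ?_ ?_, hax, hbx⟩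
    · exact hint (s := 1 / 3) (t := 2 / 3) hb1 ha2 (by norm_num)
    · exact hint (s := 1 / 3) (t := 2 / 3) ha1 hb2 (by norm_num)

end Floor

/-! ### Small lattice-geometric facts -/

/-- **Adjacent rescaled honeycomb vertices are within `δ`** (the edge length is `δ/√3`).
[folklore] -/
theorem dist_smul_hexCenter_le_of_adj {δ : ℝ} (hδ : 0 ≤ δ) {v w : HexVertex}
    (h : hexGraph.Adj v w) : dist ((δ : ℂ) * hexCenter w) ((δ : ℂ) * hexCenter v) ≤ δ := by
  -- adapted from `dist_hexCenter_le_one_of_adj` (Cruxes/DefectDecoherence/WallExitTwoPoint)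
  have hsq : Complex.normSq (hexCenter w - hexCenter v) = 1 / 3 := by
    obtain ⟨x, i⟩ := w
    obtain ⟨y, j⟩ := v
    rw [hexCenter_sub_hexCenter, normSq_add_mul_triZeta]
    fin_cases i <;> fin_cases j
    · exact absurd h (not_hexGraph_adj_of_snd_eq_holds _ _ rfl)
    · rcases (hexGraph_adj_iff_of_snd_eq_zero_holds x y).1 h.symm with rfl | rfl | rfl
      · simp; norm_num
      · simp [Pi.sub_apply]; norm_num
      · simp [Pi.sub_apply]; norm_num
    · rcases (hexGraph_adj_iff_of_snd_eq_zero_holds y x).1 h with rfl | rfl | rfl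
      · simp; norm_num
      · simp [Pi.sub_apply]; norm_num
      · simp [Pi.sub_apply]; norm_num
    · exact absurd h (not_hexGraph_adj_of_snd_eq_holds _ _ rfl)
  have h1 : dist (hexCenter w) (hexCenter v) ≤ 1 := by
    rw [dist_eq_norm, ← sq_le_one_iff₀ (norm_nonneg _), Complex.sq_norm, hsq]
    norm_num
  rw [dist_eq_norm, ← mul_sub, norm_mul, Complex.norm_real, Real.norm_of_nonneg hδ, ← dist_eq_norm]
  exact (mul_le_mul_of_nonneg_left h1 hδ).trans_eq (mul_one δ)

/-- **The flat part near a floor point is convex**: a segment between two points of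
`{im > h} ∩ B(p, r)` stays in it. [folklore] -/
theorem segment_subset_of_floor {hgt : ℝ} {p z w : ℂ} {r : ℝ}
    (hz : z ∈ {c : ℂ | hgt < c.im} ∩ ball p r) (hw : w ∈ {c : ℂ | hgt < c.im} ∩ ball p r) :
    segment ℝ z w ⊆ {c : ℂ | hgt < c.im} ∩ ball p r :=
  ((convex_halfSpace_im_gt hgt).inter (convex_ball p r)).segment_subset hz hw

/-- The first step of a walk between distinct vertices. [folklore] -/
theorem exists_adj_of_reachable {V : Type*} {G : SimpleGraph V} {u v : V} (h : G.Reachable u v)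
    (hne : u ≠ v) : ∃ w, G.Adj u w := by
  obtain ⟨p⟩ := h
  cases p with
  | nil => exact absurd rfl hne
  | cons hadj _ => exact ⟨_, hadj⟩

/-- Distinct floor mid-edges: `{a, u_a} ≠ {b, u_b}` once `a ≠ b` and `a ≠ u_b`. [folklore] -/
theorem sym2_ne_of_ne {a b ua ub : HexVertex} (hab : a ≠ b) (haub : a ≠ ub) :
    s(a, ua) ≠ s(b, ub) := by
  intro h
  rcases Sym2.eq_iff.1 h with ⟨h1, -⟩ | ⟨h1, -⟩
  · exact hab h1
  · exact haub h1

/-- `Z_Λ(s_a, s_b) > 0` as soon as there is a walk. [folklore] -/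
theorem sum_pow_length_pos {Λ : Finset HexVertex} {sa sb : Sym2 HexVertex}
    (h : Nonempty (HexMidEdgeSAW Λ sa sb)) :
    0 < ∑ γ : HexMidEdgeSAW Λ sa sb, hexCriticalFugacity ^ γ.length :=
  Finset.sum_pos (fun _ _ => pow_pos hexCriticalFugacity_pos_lt_one.1 _) Finset.univ_nonempty

/-- **Monotonicity `Z_{Λ'}(s_a, s_b) ≤ Z_Λ(s_a, s_b)` for `Λ' ⊆ Λ`**: the walks of the smaller
domain are walks of the larger one. [cite: LawlerSchrammWerner2004SAW, §3.4 ("SAW satisfies restriction")] -/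
theorem sum_pow_length_mono {Λ Λ' : Finset HexVertex} {sa sb : Sym2 HexVertex} (h : Λ' ⊆ Λ) :
    ∑ γ : HexMidEdgeSAW Λ' sa sb, hexCriticalFugacity ^ γ.length ≤
      ∑ γ : HexMidEdgeSAW Λ sa sb, hexCriticalFugacity ^ γ.length := by
  classical
  -- the inclusion of walk spaces
  let ι : HexMidEdgeSAW Λ' sa sb → HexMidEdgeSAW Λ sa sb := fun γ =>
    ⟨γ.verts, fun v hv => h (γ.subset v hv), γ.nodup, γ.isChain, γ.head_mem, γ.getLast_mem,
      γ.eq_of_nil, γ.edges_nodup, ⟨γ.fst_mem.1, γ.fst_mem.2.imp fun v hv => ⟨hv.1, h hv.2⟩⟩⟩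
  have hι : ∀ γ, (ι γ).verts = γ.verts := fun _ => rfl
  have hinj : Function.Injective ι := fun γ₁ γ₂ hγ =>
    HexMidEdgeSAW.ext (by rw [← hι, ← hι, hγ])
  calc ∑ γ : HexMidEdgeSAW Λ' sa sb, hexCriticalFugacity ^ γ.length
      = ∑ γ : HexMidEdgeSAW Λ' sa sb, hexCriticalFugacity ^ (ι γ).length := rfl
    _ = ∑ γ ∈ Finset.univ.map ⟨ι, hinj⟩, hexCriticalFugacity ^ γ.length := by
        rw [Finset.sum_map]; rfl
    _ ≤ _ := Finset.sum_le_sum_of_subset_of_nonneg (Finset.subset_univ _)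
        fun γ _ _ => pow_nonneg hexCriticalFugacity_pos_lt_one.1.le _

/-! ### A measure-theoretic triviality -/

/-- For a probability measure, `P(E ∩ I) ≤ P(E) ≤ P(E ∩ I) + (1 - P(I))`. [folklore] -/
theorem toReal_inter_le_and_le {α : Type*} [MeasurableSpace α] (μ : Measure α)
    [IsProbabilityMeasure μ] (E I : Set α) (hI : MeasurableSet I) :
    (μ (E ∩ I)).toReal ≤ (μ E).toReal ∧
      (μ E).toReal ≤ (μ (E ∩ I)).toReal + (1 - (μ I).toReal) := by
  constructor
  · exact ENNReal.toReal_mono (measure_ne_top _ _) (measure_mono Set.inter_subset_left)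
  · have h1 : μ E ≤ μ (E ∩ I) + μ Iᶜ := by
      calc μ E ≤ μ ((E ∩ I) ∪ Iᶜ) := measure_mono fun x hx => by
              by_cases h : x ∈ I
              · exact Or.inl ⟨hx, h⟩
              · exact Or.inr h
        _ ≤ μ (E ∩ I) + μ Iᶜ := measure_union_le _ _
    have h2 : (μ Iᶜ).toReal = 1 - (μ I).toReal := by
      rw [prob_compl_eq_one_sub hI, ENNReal.toReal_sub_of_le prob_le_one ENNReal.one_ne_top,
        ENNReal.toReal_one]
    rw [← h2, ← ENNReal.toReal_add (measure_ne_top _ _) (measure_ne_top _ _)]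
    exact ENNReal.toReal_mono (ENNReal.add_ne_top.2 ⟨measure_ne_top _ _, measure_ne_top _ _⟩) h1

end Summit.CriticalPhenomena.SAWScalingLimit.Theorems.ObservableToSLE.FloorRatio

end
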